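import Literature.AlgebraicGeometry.Surfaces.K3SurfaceBuskinReflectiveProofs
import Literature.AlgebraicGeometry.HodgeTheory.HodgeIndexPrimitiveAlgebraicHolds
import Literature.AlgebraicGeometry.HodgeTheory.LefschetzOneOneHolds

/-!
# Route LinearSystemTorelli — crux `MiddleDivisorSupport` (stmt-HodgeConjecture-1081), line
`ch0-null-correspondence-support`: stub F2 in its CORRECTED class-level form F2′, proved at `p = 1`

The line's ∀X attach frame (route Defs `Theorems/LinearSystemTorelliDefs.lean`, namespace
`…Theorems.Ch0Null`) composes the crux `MiddleDivisorSupport` (≡ the Hodge conjecture in the middle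
degree `2p` of a smooth projective `X^{2p}`) from three statements: F1
`CorrespondencePackagesExist`, F2 `HodgeIsolatingCorrespondence`, F3 `GeneralizedBlochNilpotence`.
Stub F2 AS TYPED asks, for every correspondence package `(Act, C)` of `X`, for a `2p`-CYCLE `Z` on
`X × X` whose cohomological action `C.act _ Z` fixes a given rational `(p,p)`-class `c` up to a
positive integer and kills every class of type `(q,0)`. That typing is mis-pinned: the five fields
of `CorrespondenceAction` (`act`,
`act_congr`, `act_diagonal`, `restrictCompl_act`, `act_eq_zero_of_isOfHodgeType`) and the package
axioms (K1)–(K3) of `IsCorrespondencePackage` tie `C.act` to the diagonal, to SOME graph cycle per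
endomorphism and to SOME power cycle only — never to the cycle CLASS of `Z` — so no argument that
produces an algebraic cohomology class on `X × X` (Lefschetz `(1,1)` + Hodge index at `p = 1`, the
Hodge conjecture for `X × X` in general) can be written against it.

The honest content of F2 lives at CLASS level, on the tree's real carriers: a class
`γ ∈ H^{2·2p}((X ⊗ X)(ℂ); ℂ)` acts as the correspondence
`corrAction μ hX hX rfl γ = pr₁_* (pr₂^* (−) ∪ γ)`
(`Literature/AlgebraicGeometry/HodgeTheory/ComplexGysinCorrespondence.lean`: the complex Gysin map
of `pr₁` for an orientation family `μ`; Voisin II (10.7)), and F2′ reads: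

> for every orientation family `μ`, every smooth projective `X^{2p}` (`p ≥ 1`) and every rational
> class `c ∈ H^{2p}(X(ℂ); ℂ)` of type `(p,p)` there is a RATIONAL ALGEBRAIC class
> `γ ∈ N^{2p}H^{4p}((X ⊗ X)(ℂ); ℂ) = algebraicClasses (X ⊗ X) (2p)` with `γ_* c = t • c` for some
> `t ≠ 0` and `γ_* η = 0` for every class `η ∈ H^q(X(ℂ); ℂ)` of type `(q,0)`, every `q`.

(Under the extra package clause "(K4): every rational algebraic class of codimension `2p` on `X × X`
is, up to a non-zero scalar, the class of a `2p`-cycle acting through `C`", F2′ re-glues to the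
cycle-level shape the frame consumes; (K4) is construction debt of F1, not of this file.)

This file proves **F2′ at `p = 1`**: `hodgeIsolatingClass_surface`, and `hodgeIsolatingClass_one` in
the exact binder shape of F2′ at `p := 1` — unconditionally, from two DISCHARGED named facts of the
tree, the Lefschetz theorem on `(1,1)`-classes (`lefschetzOneOne_rational_holds`, Voisin I
Thm. 11.30) and the Hodge index theorem for surfaces (`hodgeIndex_surface_holds`, Voisin I
Thm. 6.32). Proof: if `c = 0` take `γ = 0`. Otherwise Hodge index + Lefschetz `(1,1)` give a
rational ALGEBRAIC `(1,1)`-class `d` with `c ∪ d ≠ 0` (`exists_cup_ne_zero_of_hodgeIndex`), and `c`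
itself is algebraic; put `γ := pr₁^* c ∪ pr₂^* d ∈ H⁴((X ⊗ X)(ℂ); ℂ)`, algebraic as an exterior
product of algebraic classes (`cupProduct_map_fst_map_snd_mem_algebraicClasses`) and rational as a
cup product of rational classes. Then `γ_* y = pr₁_* (pr₂^* (y ∪ d)) ∪ c`
(`corrAction_cupProduct_map_fst_map_snd`, projection formula), and

* on `H²`: `pr₁_* pr₂^* (c ∪ d) = s • 1 ∈ H⁰` with `s ≠ 0` (`exists_eq_smul_one`,
  `complexGysin_fst_map_snd_self_ne_zero` — it is `∫ c ∪ d ≠ 0` up to the orientation), so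
  `γ_* c = s • c`;
* on `H^q`, `q < 2`: `pr₁_* pr₂^* (y ∪ d)` lands in degree `q - 2 < 0`, below the fibre degree, and
  vanishes (`complexGysin_cup_map_eq_zero_of_lt`);
* on a `(2,0)`-class `η ∈ H²`: `η ∪ d` has type `(3,1)` on a surface, hence is `0`
  (`cupProduct_eq_zero_of_hodgeType`; the cup product preserves Hodge types by de Rham's theorem in
  multiplicative form, `exists_deRhamIsoFamily_holds`, a theorem of the tree);
* for `q > 2` there is no non-zero `(q,0)`-class (`IsOfHodgeType.eq_zero_of_lt_left`).

So at `p = 1` — where the crux itself is the Lefschetz `(1,1)` theorem — the corrected F2 is a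
theorem of the tree: the record the line keeps of stub F2 (`--supports` helper of
stmt-HodgeConjecture-1081; closes no item). No definition, no new named fact, no `sorry`; the axiom
closure of both theorems is `propext`, `Classical.choice`, `Quot.sound`.

## References

* [VoisinHodgeI2002] C. Voisin, Hodge Theory and Complex Algebraic Geometry I, Thm. 6.32 (Hodge
  index theorem, §6.3.2), Thm. 11.30 (Lefschetz theorem on `(1,1)`-classes), Lemma 11.41 (Hodge
  classes on `X × Y` as morphisms of Hodge structures, §11.3.3).
* [VoisinHodgeII2003] C. Voisin, Hodge Theory and Complex Algebraic Geometry II, proof of Thm. 10.17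
  (10.7) (the action `[Z]^*`), Prop. 10.24 (correspondences supported over a small subvariety kill
  `(q,0)`-classes), §11.2.2 Conj. 11.22 (generalised Bloch conjecture; F3 of the frame).
-/

noncomputable section

-- `Summit.HodgeConjecture.HodgeConjecture.Theorems` is the mandated namespace (single-problem
-- summit: Problem = Summit), which `linter.dupNamespace` flags on every declaration; the lakefile
-- turns the linter off tree-wide (weak option), restated here so stand-alone elaboration is
-- warning-free too.
set_option linter.dupNamespace false

namespace Summit.HodgeConjecture.HodgeConjecture.Theorems.Ch0Null

open CategoryTheory AlgebraicGeometry MonoidalCategory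
open Literature.AlgebraicGeometry Literature.AlgebraicGeometry.HodgeTheory
open Literature.AlgebraicGeometry.Motives
open Literature.AlgebraicTopology.SingularHomology

/-! ### F2′ at `p = 1`: Lefschetz `(1,1)` + Hodge index, on real carriers -/

section SurfaceCase

open CartesianMonoidalCategory Literature.AlgebraicGeometry.Surfaces

/-- **F2′ at `p = 1` — a Hodge-isolating rational algebraic class on `X × X` for a surface `X`.**
For every orientation family `μ`, every smooth projective surface `X` and every rational class
`c ∈ H²(X(ℂ); ℂ)` of type `(1,1)` there is a rational algebraic class
`γ ∈ N²H⁴((X ⊗ X)(ℂ); ℂ) = algebraicClasses (X ⊗ X) 2` whose action as a correspondence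
`γ_* = pr₁_* (pr₂^* (−) ∪ γ)` (the tree's `corrAction μ`) satisfies `γ_* c = t • c` with `t ≠ 0` and
`γ_* η = 0` for every class `η` of type `(q,0)`, every `q`. Proof: `γ = 0` if `c = 0`; otherwise the
Hodge index theorem and the Lefschetz theorem on `(1,1)`-classes give a rational ALGEBRAIC `(1,1)`
class `d` with `c ∪ d ≠ 0` (and `c` is algebraic), and `γ := pr₁^* c ∪ pr₂^* d` works:
`γ_* y = pr₁_* (pr₂^* (y ∪ d)) ∪ c`, so `γ_* c = s • c` with `s • 1 = pr₁_* pr₂^* (c ∪ d)`, `s ≠ 0`;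
`γ_*` vanishes on `H^q` for `q < 2` (below the fibre degree), on `(2,0)`-classes (`(2,0) ∪ (1,1)`
has type `(3,1)`, zero on a surface) and there is no non-zero `(q,0)`-class for `q > 2`.
[cite: VoisinHodgeI2002, Thm. 11.30 and Thm. 6.32]
[cite: VoisinHodgeII2003, Conj. 11.22 and Prop. 10.24] -/
theorem hodgeIsolatingClass_surface (μ : OrientationFamily) {X : SchemeOver ℂ}
    (hX : IsSmoothProjective 2 X) (c : complexBetti X (2 * 1))
    (hc : IsRationalClass c) (hH : IsOfHodgeType 2 X (2 * 1) 1 1 c) :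
    ∃ γ ∈ algebraicClasses (X ⊗ X) 2, IsRationalClass γ ∧ ∃ t : ℂ, t ≠ 0 ∧
      corrAction μ hX hX (rfl : 2 * 1 + 2 * 2 = 2 * 1 + 2 * 2) γ c = t • c ∧
      ∀ (q : ℕ) (η : complexBetti X q), IsOfHodgeType 2 X q q 0 η →
        corrAction μ hX hX (rfl : q + 2 * 2 = q + 2 * 2) γ η = 0 := by
  have hXX := IsSmoothProjective.tensor_holds hX hX
  have hI := hodgePQ_independent_of_hodgeModel_holds
  obtain ⟨A⟩ := nonempty_hodgeModel_holds (n := 2) (X := X) hX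
  have hcup : CupPreservesHodgeType 2 X :=
    cupPreservesHodgeType_of_nonempty_hodgeModel hI nonempty_hodgeModel_holds
      (fun E _ _ _ ↦ Literature.NumberTheory.Transcendental.exists_deRhamIsoFamily_holds E) hX
  by_cases hc0 : c = 0
  · subst hc0
    refine ⟨0, Submodule.zero_mem _, IsRationalClass.zero, 1, one_ne_zero, ?_, fun q η _ ↦ ?_⟩
    · simp only [map_zero, smul_zero]
    · simp only [map_zero, LinearMap.zero_apply]
  obtain ⟨d, hdQ, hd11, hdN, hcd⟩ :=
    exists_cup_ne_zero_of_hodgeIndex hodgeIndex_surface_holds lefschetzOneOne_rational_holds hX c hc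
      hH hc0
  have hcN : c ∈ algebraicClasses X 1 := lefschetzOneOne_rational_holds hX c hc hH
  -- the scalar: `pr₁_*(pr₂^*(c ∪ d)) = s • 1` with `s ≠ 0`
  obtain ⟨s, hs⟩ := exists_eq_smul_one μ hX
    (complexGysin μ hXX hX (fst X X) (rfl : 2 * 2 + 2 * 2 = 0 + 2 * (2 + 2))
      (complexBetti.map (snd X X) (2 * 2) (cupProduct (rfl : 2 * 1 + 2 * 1 = 2 * 2) c d)))
  have hs0 : s ≠ 0 := by
    rintro rfl
    rw [zero_smul] at hs
    exact complexGysin_fst_map_snd_self_ne_zero μ hX hcd hs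
  refine ⟨cupProduct (rfl : 2 * 1 + 2 * 1 = 2 * 2) (complexBetti.map (fst X X) (2 * 1) c)
      (complexBetti.map (snd X X) (2 * 1) d), ?_, (hc.map _).cup _ (hdQ.map _),
    s, hs0, ?_, fun q η hη ↦ ?_⟩
  · -- algebraic: exterior product of algebraic classes (`1 + 1 = 2` normalised by `simpa`)
    simpa using cupProduct_map_fst_map_snd_mem_algebraicClasses hX hX hcN hdN
  · rw [corrAction_cupProduct_map_fst_map_snd hX c d c, hs, map_smul, cupProduct_one]
  · rcases lt_trichotomy q 2 with hq | rfl | hq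
    · -- `q < 2`: below the fibre degree
      rw [corrAction_apply, cupProduct_map_snd_cupProduct_map_fst_map_snd
        (rfl : 2 * 1 + 2 * 1 = 2 * 2) rfl (rfl : q + 2 * 1 = q + 2 * 1) (by omega) ⟨q, by ring⟩
        η c d]
      exact complexGysin_cup_map_eq_zero_of_lt hXX hX (fst X X) _ _ (by omega) c _
    · -- `q = 2`: `η ∪ d = 0` by Hodge types `(2,0) ∪ (1,1)`
      have h0 : cupProduct (rfl : 2 + 2 * 1 = 2 + 2 * 1) η d = 0 :=
        cupProduct_eq_zero_of_hodgeType hI hX A hcup _ (p := 2) (q := 0) (p' := 1) (q' := 1)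
          (by omega) ((hI.isOfHodgeType_iff hX A).1 hη) ((hI.isOfHodgeType_iff hX A).1 hd11)
      rw [corrAction_apply, cupProduct_map_snd_cupProduct_map_fst_map_snd
        (rfl : 2 * 1 + 2 * 1 = 2 * 2) rfl (rfl : 2 + 2 * 1 = 2 + 2 * 1) (by omega) ⟨2, by ring⟩
        η c d, h0, map_zero, map_zero, map_zero]
    · -- `q > 2`: no `(q,0)`-classes
      rw [hη.eq_zero_of_lt_left hq, map_zero]

/-- **F2′ at `p = 1`, in the exact binder shape of the corrected stub F2**
(`IsSmoothProjective (2 * 1)`, degrees `2 * 1` and `q + 2 * (2 * 1)`, `⦃X⦄`): for every orientation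
family `μ`, every smooth projective `X` of dimension `2 · 1` and every rational `(1,1)`-class
`c ∈ H^{2·1}(X(ℂ); ℂ)` there is a rational algebraic class `γ ∈ algebraicClasses (X ⊗ X) (2 · 1)`
with `γ_* c = t • c`, `t ≠ 0`, and
`γ_* η = 0` for every `(q,0)`-class `η`, every `q` — by `hodgeIsolatingClass_surface` (Lefschetz
`(1,1)` + Hodge index; `2 * 1` and `2` agree definitionally). The statement is written as ONE
`∀`-term on one line (same declaration type, binder names and binder kinds as the binder form
`(μ : OrientationFamily) ⦃X : SchemeOver ℂ⦄ (hX …) (c …) (hc …) (hH …) : ∃ γ ∈ …`): it is the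
registered sub-goal of stmt-HodgeConjecture-1081 this `--supports` file proves, matched by the
gate on its verbatim header.
[cite: VoisinHodgeI2002, Thm. 11.30 and Thm. 6.32]
[cite: VoisinHodgeII2003, Conj. 11.22 and Prop. 10.24] -/
theorem hodgeIsolatingClass_one : ∀ (μ : OrientationFamily) ⦃X : SchemeOver ℂ⦄ (hX : IsSmoothProjective (2 * 1) X) (c : complexBetti X (2 * 1)) (hc : IsRationalClass c) (hH : IsOfHodgeType (2 * 1) X (2 * 1) 1 1 c), ∃ γ ∈ algebraicClasses (X ⊗ X) (2 * 1), IsRationalClass γ ∧ ∃ t : ℂ, t ≠ 0 ∧ corrAction μ hX hX rfl γ c = t • c ∧ ∀ (q : ℕ) (η : complexBetti X q), IsOfHodgeType (2 * 1) X q q 0 η → corrAction μ hX hX (rfl : q + 2 * (2 * 1) = q + 2 * (2 * 1)) γ η = 0 :=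
  fun μ _ hX c hc hH ↦ hodgeIsolatingClass_surface μ hX c hc hH

end SurfaceCase

end Summit.HodgeConjecture.HodgeConjecture.Theorems.Ch0Null

end
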